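import Summits.NavierStokesRegularity.FluidComputer.PalasekTowerMatchedGerm
import Literature.Analysis.FluidPDE.NSLerayHopfABCEnergyIdentity

/-!
# The matched preparation germ, II: FINITE ENERGY on a slab and the SMALL-FORCE WINDOW after the matched instant

Cell `ns-blowup`, seat `ns-blowup-ecbridge-3` (g2); companion of `PalasekTowerMatchedGerm.lean` (the
first-order NS-matched germ `germ t = α(t) • U + β(t) • V`, `V = P(νΔU − (U·∇)U)`, of a compactly
supported profile `U`). LABEL: E–C typing (KERNEL, proofs only). WHAT THIS IS NOT: not Navier–Stokes
evidence — an `L²` bookkeeping lemma about a prescribed field; no stage, host or tower is constructed.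

The germ is NOT compactly supported (off `tsupport U` it is the potential flow `−β ∇π` with the
dipole tail of `π = Δ⁻¹ div W`), but it has finite energy: `U` and the drift `W` are continuous with
compact support, and `∇π ∈ L²(ℝ³)` coordinatewise by the tree's
`AlbrittonBrueColombo2022.memLp_fderiv_divPotential_apply` (`∂ᵥ π[W] = π[∂ᵥ W]` is again the
Newtonian potential of a divergence, with dipole decay). `energy_germ` is the `energy` clause of a
registered stage (`∃ C < ∞, ∀ t ∈ [0, T], ∫ |germ t|² ≤ C`) under bounds `|α| ≤ A`, `|β| ≤ B` on the
slab. `exists_window_norm_germResid_le` is the WINDOW BOUND: matched at `τ₀` and with the profile in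
`B̄(0, R)`, the residual (jointly continuous — `germResid_eq`, `continuous_uncurry_germResid` —, zero
at `τ₀`, zero outside the ball) is `≤ δ` everywhere on `[τ₀, τ₀ + ε]` for some `ε = ε(δ) > 0`; with
`δ = c₄ Y₀` and a fade shorter than `ε` the schedule force `fade • germResid` meets `push_small` for ANY
prescribed `c₄ > 0` (the anchor, not the force, is then the binding constraint on the design).

References: A. J. Majda, A. L. Bertozzi, *Vorticity and Incompressible Flow* (CUP 2002), §1.8
Prop. 1.16 [cite: MajdaBertozziCUP2002, §1.8 Prop. 1.16]; C. L. Fefferman, Clay problem description,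
(7) (finite energy) [cite: FeffermanClay2006, (7)].
-/

noncomputable section

namespace Summit.NavierStokesRegularity.FluidComputer.PalasekTowerClayBridge.Germ

open Set Function Filter Topology InnerProductSpace MeasureTheory
open scoped Topology ContDiff ENNReal Laplacian RealInnerProductSpace

open Literature.Analysis.FluidPDE

variable {ν : ℝ} {U : EuclideanSpace ℝ (Fin 3) → EuclideanSpace ℝ (Fin 3)} {α β : ℝ → ℝ}

section Energy

variable (hU : ContDiff ℝ ∞ U) (hUc : HasCompactSupport U)
include hU hUc

/-- **`∇π ∈ L²(ℝ³)`**: each partial derivative of the potential is again a Newtonian potential of a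
divergence (`AlbrittonBrueColombo2022.memLp_fderiv_divPotential_apply`, NSLerayHopfABCEnergyIdentity), and `∇π = Σᵢ (∂ᵢπ) eᵢ`. [folklore] -/
theorem memLp_gradient_pot (ν : ℝ) : MemLp (gradient (pot ν U)) 2 volume := by
  set b := EuclideanSpace.basisFun (Fin 3) ℝ with hb
  have hW := contDiff_drift hU ν
  have hWc := hasCompactSupport_drift (U := U) hUc ν
  -- the coordinates of `∇π` are the partial derivatives `∂ᵢ π`, each in `L²`
  have hcoord : ∀ x, gradient (pot ν U) x = ∑ i, (fderiv ℝ (pot ν U) x (b i)) • b i := by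
    intro x
    have h := b.sum_repr' (gradient (pot ν U) x)
    rw [← h]
    refine Finset.sum_congr rfl fun i _ => ?_
    congr 1
    rw [real_inner_comm, gradient, InnerProductSpace.toDual_symm_apply]
  have hg : MemLp (fun x => ∑ i, ‖fderiv ℝ (pot ν U) x (b i)‖) 2 volume :=
    memLp_finsetSum Finset.univ fun i _ =>
      (AlbrittonBrueColombo2022.memLp_fderiv_divPotential_apply hW hWc (b i)).norm
  have hmeas : AEStronglyMeasurable (gradient (pot ν U)) volume :=
    (contDiff_gradient_of_contDiff_top (contDiff_pot hU hUc ν)).continuous.aestronglyMeasurable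
  refine hg.mono' hmeas (Eventually.of_forall fun x => ?_)
  rw [hcoord x]
  refine (norm_sum_le _ _).trans (le_of_eq (Finset.sum_congr rfl fun i _ => ?_))
  rw [norm_smul, b.orthonormal.1 i, mul_one]

/-- **`V ∈ L²(ℝ³)`** (`V = W − ∇π`, `W` continuous with compact support). [folklore] -/
theorem memLp_accel (ν : ℝ) : MemLp (accel ν U) 2 volume := by
  have hW : MemLp (drift ν U) 2 volume :=
    (contDiff_drift hU ν).continuous.memLp_of_hasCompactSupport (hasCompactSupport_drift hUc ν)
  have h := hW.sub (memLp_gradient_pot hU hUc ν)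
  have e : accel ν U = drift ν U - gradient (pot ν U) := by
    funext x; exact accel_apply ν x
  rw [e]
  exact h

/-- The germ's time slices are in `L²(ℝ³)`. [folklore] -/
theorem memLp_germ (t : ℝ) : MemLp (germ ν U α β t) 2 volume := by
  have h1 : MemLp (fun x => α t • U x) 2 volume :=
    (hU.continuous.memLp_of_hasCompactSupport hUc).const_smul (α t)
  have h2 : MemLp (fun x => β t • accel ν U x) 2 volume := (memLp_accel hU hUc ν).const_smul (β t)
  exact h1.add h2

omit hU hUc in
/-- `∫⁻ ‖f‖ₑ² = (eLpNorm f 2)²` (a local copy of the tree's `lintegral_enorm_sq_eq_eLpNorm_sq`,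
`FourierL2Convolution.lean`, not imported here). [folklore] -/
private theorem lintegral_enorm_sq_eq (f : EuclideanSpace ℝ (Fin 3) → EuclideanSpace ℝ (Fin 3)) :
    ∫⁻ x, ‖f x‖ₑ ^ 2 = eLpNorm f 2 volume ^ 2 := by
  rw [eLpNorm_eq_lintegral_rpow_enorm_toReal (by norm_num) (by norm_num), ENNReal.toReal_ofNat,
    ← ENNReal.rpow_natCast, ← ENNReal.rpow_mul]
  norm_num

/-- **FINITE ENERGY, UNIFORMLY ON A SLAB**: if `|α| ≤ A` and `|β| ≤ B` on `[0, T]` then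
`∫ |germ t|² ≤ C < ∞` for all `t ∈ [0, T]` (`C = (A‖U‖₂ + B‖V‖₂)²`) — the `energy` clause of a
registered stage. [folklore] -/
theorem energy_germ {T A B : ℝ} (hA : ∀ t ∈ Icc 0 T, |α t| ≤ A) (hB : ∀ t ∈ Icc 0 T, |β t| ≤ B) :
    ∃ C : ℝ≥0∞, C < ⊤ ∧ ∀ t ∈ Icc 0 T, ∫⁻ x, ‖germ ν U α β t x‖ₑ ^ 2 ≤ C := by
  have hUm : MemLp U 2 volume := hU.continuous.memLp_of_hasCompactSupport hUc
  have hVm : MemLp (accel ν U) 2 volume := memLp_accel hU hUc ν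
  set M : ℝ≥0∞ := ENNReal.ofReal A * eLpNorm U 2 volume +
    ENNReal.ofReal B * eLpNorm (accel ν U) 2 volume with hM
  have hMtop : M < ⊤ := by
    refine ENNReal.add_lt_top.2 ⟨?_, ?_⟩
    · exact ENNReal.mul_lt_top ENNReal.ofReal_lt_top hUm.eLpNorm_lt_top
    · exact ENNReal.mul_lt_top ENNReal.ofReal_lt_top hVm.eLpNorm_lt_top
  refine ⟨M ^ 2, ENNReal.pow_lt_top hMtop, fun t ht => ?_⟩
  rw [lintegral_enorm_sq_eq]
  suffices hle : eLpNorm (germ ν U α β t) 2 volume ≤ M by gcongr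
  have h1 : AEStronglyMeasurable (fun x => α t • U x) volume :=
    (hUm.const_smul (α t)).aestronglyMeasurable
  have h2 : AEStronglyMeasurable (fun x => β t • accel ν U x) volume :=
    (hVm.const_smul (β t)).aestronglyMeasurable
  have hsplit : germ ν U α β t = (fun x => α t • U x) + fun x => β t • accel ν U x := rfl
  calc eLpNorm (germ ν U α β t) 2 volume
      ≤ eLpNorm (fun x => α t • U x) 2 volume + eLpNorm (fun x => β t • accel ν U x) 2 volume := by
        rw [hsplit]; exact eLpNorm_add_le h1 h2 (by norm_num)
    _ = ‖α t‖ₑ * eLpNorm U 2 volume + ‖β t‖ₑ * eLpNorm (accel ν U) 2 volume := by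
        rw [show (fun x => α t • U x) = α t • U from rfl, eLpNorm_const_smul,
          show (fun x => β t • accel ν U x) = β t • accel ν U from rfl, eLpNorm_const_smul]
    _ ≤ M := by
        have hα' : ‖α t‖ₑ ≤ ENNReal.ofReal A := by
          rw [Real.enorm_eq_ofReal_abs]; exact ENNReal.ofReal_le_ofReal (hA t ht)
        have hβ' : ‖β t‖ₑ ≤ ENNReal.ofReal B := by
          rw [Real.enorm_eq_ofReal_abs]; exact ENNReal.ofReal_le_ofReal (hB t ht)
        show _ ≤ ENNReal.ofReal A * eLpNorm U 2 volume + ENNReal.ofReal B * eLpNorm (accel ν U) 2 volume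
        gcongr

end Energy

/-! ## The small-force window after the matched instant -/

section Window

variable (hU : ContDiff ℝ ∞ U) (hUc : HasCompactSupport U)
include hU hUc

/-- The Laplacian of a germ slice: `Δ(germ t) = α Δ U + β Δ V`. [folklore] -/
theorem laplacian_germ (t : ℝ) (x : EuclideanSpace ℝ (Fin 3)) :
    (Δ (germ ν U α β t)) x = α t • (Δ U) x + β t • (Δ (accel ν U)) x := by
  have e : germ ν U α β t = (α t • U) + (β t • accel ν U) := by funext y; rfl
  have hU2 : ContDiff ℝ 2 U := hU.of_le (by norm_cast)
  have hV2 : ContDiff ℝ 2 (accel ν U) := (contDiff_accel hU hUc ν).of_le (by norm_cast)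
  have h1 : ContDiffAt ℝ 2 (α t • U) x := (hU2.const_smul (α t)).contDiffAt
  have h2 : ContDiffAt ℝ 2 (β t • accel ν U) x := (hV2.const_smul (β t)).contDiffAt
  rw [e, h1.laplacian_add h2, InnerProductSpace.laplacian_smul _ hU2.contDiffAt,
    InnerProductSpace.laplacian_smul _ hV2.contDiffAt]

/-- The convective term of a germ slice, expanded bilinearly. [folklore] -/
theorem convect_germ (t : ℝ) (x : EuclideanSpace ℝ (Fin 3)) :
    convect (germ ν U α β t) (germ ν U α β t) x =
      α t ^ 2 • convect U U x +
        (α t * β t) • (fderiv ℝ U x (accel ν U x) + fderiv ℝ (accel ν U) x (U x)) +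
        β t ^ 2 • convect (accel ν U) (accel ν U) x := by
  have hdU : DifferentiableAt ℝ U x := (hU.differentiable (by simp)) x
  have hdV : DifferentiableAt ℝ (accel ν U) x :=
    ((contDiff_accel hU hUc ν).differentiable (by simp)) x
  have hdU' : DifferentiableAt ℝ (fun y => α t • U y) x := hdU.const_smul (α t)
  have hdV' : DifferentiableAt ℝ (fun y => β t • accel ν U y) x := hdV.const_smul (β t)
  have hD : fderiv ℝ (germ ν U α β t) x = α t • fderiv ℝ U x + β t • fderiv ℝ (accel ν U) x := by
    show fderiv ℝ (fun y => α t • U y + β t • accel ν U y) x = _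
    rw [fderiv_fun_add hdU' hdV', fderiv_fun_const_smul hdU, fderiv_fun_const_smul hdV]
  rw [convect_apply, hD, convect_apply, convect_apply]
  show (α t • fderiv ℝ U x + β t • fderiv ℝ (accel ν U) x) (α t • U x + β t • accel ν U x) = _
  simp only [_root_.add_apply, _root_.smul_apply, map_add, map_smul, smul_add, smul_smul, sq]
  module

/-- **The residual, written out** (for continuity and estimates). [folklore] -/
theorem germResid_eq (t : ℝ) (x : EuclideanSpace ℝ (Fin 3)) :
    germResid ν U α β t x =
      deriv α t • U x + deriv β t • accel ν U x +
        (α t ^ 2 • convect U U x +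
          (α t * β t) • (fderiv ℝ U x (accel ν U x) + fderiv ℝ (accel ν U) x (U x)) +
          β t ^ 2 • convect (accel ν U) (accel ν U) x) -
        ν • (α t • (Δ U) x + β t • (Δ (accel ν U)) x) +
        (deriv β t • gradient (pot ν U) x -
          β t ^ 2 • gradient (fun y => 2⁻¹ * ‖gradient (pot ν U) y‖ ^ 2) x) := by
  rw [germResid, convect_germ hU hUc, laplacian_germ hU hUc, gradient_germPres hU hUc]

variable (hα : ContDiff ℝ ∞ α) (hβ : ContDiff ℝ ∞ β)
include hα hβ

/-- The residual is jointly continuous in `(t, x)`. [folklore] -/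
theorem continuous_uncurry_germResid : Continuous (uncurry (germResid ν U α β)) := by
  have hV := contDiff_accel hU hUc ν
  have hπ := contDiff_pot hU hUc ν
  have cU : Continuous U := hU.continuous
  have cV : Continuous (accel ν U) := hV.continuous
  have cDU : Continuous (fderiv ℝ U) := hU.continuous_fderiv (by simp)
  have cDV : Continuous (fderiv ℝ (accel ν U)) := hV.continuous_fderiv (by simp)
  have cΔU : Continuous (Δ U) :=
    (contDiff_laplacian (n := 0) (hU.of_le (by norm_cast))).continuous
  have cΔV : Continuous (Δ (accel ν U)) :=
    (contDiff_laplacian (n := 0) (hV.of_le (by norm_cast))).continuous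
  have cG : Continuous (gradient (pot ν U)) := (contDiff_gradient_of_contDiff_top hπ).continuous
  have cN : Continuous (gradient fun y => 2⁻¹ * ‖gradient (pot ν U) y‖ ^ 2) :=
    (contDiff_gradient_of_contDiff_top
      (contDiff_const.mul ((contDiff_gradient_of_contDiff_top hπ).norm_sq ℝ))).continuous
  have cα : Continuous α := hα.continuous
  have cβ : Continuous β := hβ.continuous
  have cα' : Continuous (deriv α) := (hα.continuous_deriv (by simp))
  have cβ' : Continuous (deriv β) := (hβ.continuous_deriv (by simp))
  have e : uncurry (germResid ν U α β) = fun q : ℝ × EuclideanSpace ℝ (Fin 3) =>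
      deriv α q.1 • U q.2 + deriv β q.1 • accel ν U q.2 +
        (α q.1 ^ 2 • convect U U q.2 +
          (α q.1 * β q.1) • (fderiv ℝ U q.2 (accel ν U q.2) + fderiv ℝ (accel ν U) q.2 (U q.2)) +
          β q.1 ^ 2 • convect (accel ν U) (accel ν U) q.2) -
        ν • (α q.1 • (Δ U) q.2 + β q.1 • (Δ (accel ν U)) q.2) +
        (deriv β q.1 • gradient (pot ν U) q.2 -
          β q.1 ^ 2 • gradient (fun y => 2⁻¹ * ‖gradient (pot ν U) y‖ ^ 2) q.2) := by
    funext q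
    exact germResid_eq hU hUc q.1 q.2
  rw [e]
  have c1 := continuous_fst (X := ℝ) (Y := EuclideanSpace ℝ (Fin 3))
  have c2 := continuous_snd (X := ℝ) (Y := EuclideanSpace ℝ (Fin 3))
  have cconvU : Continuous fun y => convect U U y :=
    (show Continuous fun y => fderiv ℝ U y (U y) from cDU.clm_apply cU)
  have cconvV : Continuous fun y => convect (accel ν U) (accel ν U) y :=
    (show Continuous fun y => fderiv ℝ (accel ν U) y (accel ν U y) from cDV.clm_apply cV)
  have cX1 : Continuous fun y => fderiv ℝ U y (accel ν U y) := cDU.clm_apply cV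
  have cX2 : Continuous fun y => fderiv ℝ (accel ν U) y (U y) := cDV.clm_apply cU
  refine ((((cα'.comp c1).smul (cU.comp c2)).add ((cβ'.comp c1).smul (cV.comp c2))).add
    ((((((cα.comp c1).pow 2).smul (cconvU.comp c2)).add
      (((cα.comp c1).mul (cβ.comp c1)).smul ((cX1.comp c2).add (cX2.comp c2)))).add
      (((cβ.comp c1).pow 2).smul (cconvV.comp c2))))).sub
    ((((cα.comp c1).smul (cΔU.comp c2)).add
      ((cβ.comp c1).smul (cΔV.comp c2))).const_smul ν) |>.add
    (((cβ'.comp c1).smul (cG.comp c2)).sub (((cβ.comp c1).pow 2).smul (cN.comp c2)))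

/-- **THE SMALL-FORCE WINDOW**: if the germ is matched at `τ₀` (`α(τ₀) = 1`, `α'(τ₀) = 0`,
`β(τ₀) = 0`, `β'(τ₀) = 1`) and the profile sits in `B̄(0, R)`, then for every `δ > 0` there is
`ε > 0` with `‖germResid t x‖ ≤ δ` for ALL `x` and all `t ∈ [τ₀, τ₀ + ε]` — the residual is jointly
continuous, vanishes at `τ₀`, and vanishes outside the ball at all times (uniform continuity on the
compact `[τ₀, τ₀ + 1] × B̄(0, R)`). With `δ := c₄ Y₀` and a fade of length `≤ ε` this is the window
bound `push_small` of a schedule whose level-`0` host is the germ, for ANY prescribed `c₄ > 0`.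
[cite: FeffermanClay2006, (1)] -/
theorem exists_window_norm_germResid_le {τ₀ R : ℝ} (hα0 : α τ₀ = 1) (hα1 : deriv α τ₀ = 0)
    (hβ0 : β τ₀ = 0) (hβ1 : deriv β τ₀ = 1) (hR : tsupport U ⊆ Metric.closedBall 0 R)
    {δ : ℝ} (hδ : 0 < δ) :
    ∃ ε : ℝ, 0 < ε ∧ ∀ t ∈ Icc τ₀ (τ₀ + ε), ∀ x : EuclideanSpace ℝ (Fin 3),
      ‖germResid ν U α β t x‖ ≤ δ := by
  set F := uncurry (germResid ν U α β) with hF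
  have hFc : Continuous F := continuous_uncurry_germResid hU hUc hα hβ
  set K : Set (ℝ × EuclideanSpace ℝ (Fin 3)) := Icc τ₀ (τ₀ + 1) ×ˢ Metric.closedBall 0 R with hK
  have hKc : IsCompact K := isCompact_Icc.prod (isCompact_closedBall 0 R)
  have hUC : UniformContinuousOn F K := hKc.uniformContinuousOn_of_continuous hFc.continuousOn
  obtain ⟨η, hη, hηF⟩ := Metric.uniformContinuousOn_iff.1 hUC δ hδ
  refine ⟨min 1 (η / 2), by positivity, fun t ht x => ?_⟩
  have ht1 : t ≤ τ₀ + 1 := ht.2.trans (by linarith [min_le_left (1 : ℝ) (η / 2)])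
  have htη : t - τ₀ < η := by
    have hmin : min 1 (η / 2) ≤ η / 2 := min_le_right _ _
    linarith [ht.2]
  by_cases hx : ‖x‖ ≤ R
  · -- inside the ball: compare with the matched instant
    have hp : (t, x) ∈ K := ⟨⟨ht.1, ht1⟩, by simpa [Metric.mem_closedBall, dist_zero_right] using hx⟩
    have hq : (τ₀, x) ∈ K :=
      ⟨⟨le_rfl, by linarith⟩, by simpa [Metric.mem_closedBall, dist_zero_right] using hx⟩
    have hdist : dist (t, x) (τ₀, x) < η := by
      rw [Prod.dist_eq, dist_self, max_eq_left dist_nonneg, Real.dist_eq,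
        abs_of_nonneg (by linarith [ht.1])]
      exact htη
    have h := hηF (t, x) hp (τ₀, x) hq hdist
    have h0 : F (τ₀, x) = 0 := by
      simp only [hF, uncurry_apply_pair]
      exact germResid_eq_zero_of_matched hα0 hα1 hβ0 hβ1 x
    rw [h0, dist_zero_right] at h
    exact h.le
  · -- outside the ball: the residual is zero
    rw [germResid_eq_zero_of_norm_gt hU hUc hR t (not_le.1 hx), norm_zero]
    exact hδ.le

end Window

end Summit.NavierStokesRegularity.FluidComputer.PalasekTowerClayBridge.Germ

end
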